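import Summits.QuantumFields.YangMills.Theorems.FluctuationComparisonRegPrIntLS2BetaConeFilling
import Mathlib.Data.Nat.Dist
import HarnessLib

/-!
# (BG∞) ∕ `hsupp⁺` — (G7-T)-lattice, FILE T0 OF UV3-NODE §116.4: THE RING MODULUS OF THE DISCRETE SQUARE — per-bond oscillation `η` along the boundary ring of `{0..n}²`
# gives the `ℓ¹`-MODULUS `dist1 (φ P · (φ Q)⁻¹) ≤ 2η·|P − Q|₁` for every pair of boundary sites (the ring distance is at most twice the `ℓ¹` distance) — the hypothesis
# of T2 ✓∕⧗`…ConeOnSquare.exists_coneOnSquare` (iii) from the per-bond letters the tube data come with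

Cell `ym3-torus` (YM ladder rung R3 = continuum `SU(2)` Yang–Mills on the three-torus at fixed lattice data — a RUNG: NOT d = 4, NOT infinite volume, NOT a mass gap,
NOT Clay).  Width seat «width 5» `ym3-torus-px5` (gen 24), FREE px helper on crux `stmt-QuantumFields-20520` (`…Theses.UnitScaleTilt.FluctuationComparisonRegPrIntL`);
`--kind proof --supports stmt-QuantumFields-20520 --as helper`, count-neutral, DEFINITION-FREE (0 `def`, 0 `instance`, 0 `notation`, 0 `sorry`; default heartbeats).

WHY.  T2's step bound reads the boundary data's regularity as an `ℓ¹`-modulus on boundary PAIRS (`dist1 (φ P·(φ Q)⁻¹) ≤ λ·(Nat.dist P.1 Q.1 + Nat.dist P.2 Q.2)`), because the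
radial projections of two neighbouring interior sites are boundary sites some `ℓ¹` distance apart, not lattice neighbours; the tube data of §116.3 Stage T come with PER-BOND
letters (Step A's `2δ′`, Stage I's `K_I∕ρ′`; px19 g25's ✓∕⧗`…BoxOscillation.dist1_axisSegment_le` sums them along ONE axis segment).  THIS FILE closes the gap on the square:
along the boundary ring any two sites are joined by at most three straight boundary segments of total length `≤ 2|P − Q|₁` (same or adjacent sides: exactly `|P − Q|₁` through
the common corner; opposite sides: around the shorter way, `≤ 2n ≤ 2|P − Q|₁`), so per-bond `η` gives modulus `λ := 2η`.

WHAT IS PROVED (sorry-free; any `GaugeGroup`; `φ : ℕ × ℕ → G`; «boundary» = `i ≤ n ∧ j ≤ n ∧ (i = 0 ∨ i = n ∨ j = 0 ∨ j = n)`).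
§1 `dist1_row_segment_le` ∕ `dist1_col_segment_le` (along a boundary row `j ∈ {0, n}` ∕ column `i ∈ {0, n}`: `dist1 (φ (i,j)·(φ (i+d,j))⁻¹) ≤ d·η`, induction + ✓`dist1_mul_inv_le_via`),
their two-sided `Nat.dist` forms; §2 ★★★ `dist1_boundary_le_two_mul_l1 (hadj : per-bond η on boundary-adjacent pairs) : ∀ boundary P Q, dist1 (φ P·(φ Q)⁻¹) ≤ 2η·(Nat.dist P.1 Q.1 + Nat.dist P.2 Q.2)`
(16 side-pairs, each a 1–3 segment path).

DOMAIN SENTENCE.  One square, any `n`; pure bookkeeping; the per-bond hypothesis is the consumer's (tube data).  HONEST SCOPE: [folklore]; `hBG`∕`hsupp⁺` CONJECTURE (plan §116 +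
FL-39∕40), NOT proved; nothing of Bałaban's; GAP♯∘ (registry v11; v12.1 adopted-in-waiting) ∕ S2β ∕ 20520 ∕ 19936 ∕ 19200 ∕ `YM3TorusSU2` NOT proved; no registered stub closed;
rung R3 — NOT d = 4, NOT infinite volume, NOT a mass gap, NOT Clay; the Yang–Mills mass gap is NOT proved.
-/

set_option autoImplicit false

namespace Summit.QuantumFields.YangMills.Theorems.FluctuationComparisonRegPrIntLS2BetaSquareRingModulus

open Literature.MathematicalPhysics.QuantumFieldTheory.Balaban1983to89
open Summit.QuantumFields.YangMills.Theorems.FluctuationComparisonRegPrIntLS2BetaConeFilling (dist1_mul_inv_le_via)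

variable {G : Type*} [GaugeGroup G]

/-! ## §1 Straight boundary segments -/

/-- Along a boundary ROW (`j = 0` or `j = n`): `dist1 (φ (i,j)·(φ (i+d,j))⁻¹) ≤ d·η` for `i + d ≤ n`. [folklore] -/
theorem dist1_row_segment_le (n : ℕ) (φ : ℕ × ℕ → G) {η : ℝ}
    (hadj : ∀ P Q : ℕ × ℕ, P.1 ≤ n → P.2 ≤ n → (P.1 = 0 ∨ P.1 = n ∨ P.2 = 0 ∨ P.2 = n) → Q.1 ≤ n → Q.2 ≤ n → (Q.1 = 0 ∨ Q.1 = n ∨ Q.2 = 0 ∨ Q.2 = n) →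
      Nat.dist P.1 Q.1 + Nat.dist P.2 Q.2 = 1 → dist1 (φ P * (φ Q)⁻¹) ≤ η)
    (j : ℕ) (hj : j = 0 ∨ j = n) (i d : ℕ) (hid : i + d ≤ n) :
    dist1 (φ (i, j) * (φ (i + d, j))⁻¹) ≤ d * η := by
  induction d with
  | zero => simp [GaugeGroup.dist1_one]
  | succ d ih =>
    have hd : i + d ≤ n := by omega
    have hstep : dist1 (φ (i + d, j) * (φ (i + (d + 1), j))⁻¹) ≤ η := by
      refine hadj (i + d, j) (i + (d + 1), j) hd (by omega) (by omega) (by omega) (by omega) (by omega) ?_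
      simp only [Nat.dist_self, add_zero]
      rw [Nat.dist_eq_sub_of_le (by omega)]; omega
    calc dist1 (φ (i, j) * (φ (i + (d + 1), j))⁻¹)
        ≤ dist1 (φ (i, j) * (φ (i + d, j))⁻¹) + dist1 (φ (i + d, j) * (φ (i + (d + 1), j))⁻¹) := dist1_mul_inv_le_via _ _ _
      _ ≤ d * η + η := add_le_add (ih hd) hstep
      _ = ((d + 1 : ℕ) : ℝ) * η := by push_cast; ring

/-- Along a boundary COLUMN (`i = 0` or `i = n`): `dist1 (φ (i,j)·(φ (i,j+d))⁻¹) ≤ d·η` for `j + d ≤ n`. [folklore] -/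
theorem dist1_col_segment_le (n : ℕ) (φ : ℕ × ℕ → G) {η : ℝ}
    (hadj : ∀ P Q : ℕ × ℕ, P.1 ≤ n → P.2 ≤ n → (P.1 = 0 ∨ P.1 = n ∨ P.2 = 0 ∨ P.2 = n) → Q.1 ≤ n → Q.2 ≤ n → (Q.1 = 0 ∨ Q.1 = n ∨ Q.2 = 0 ∨ Q.2 = n) →
      Nat.dist P.1 Q.1 + Nat.dist P.2 Q.2 = 1 → dist1 (φ P * (φ Q)⁻¹) ≤ η)
    (i : ℕ) (hi : i = 0 ∨ i = n) (j d : ℕ) (hjd : j + d ≤ n) :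
    dist1 (φ (i, j) * (φ (i, j + d))⁻¹) ≤ d * η := by
  induction d with
  | zero => simp [GaugeGroup.dist1_one]
  | succ d ih =>
    have hd : j + d ≤ n := by omega
    have hstep : dist1 (φ (i, j + d) * (φ (i, j + (d + 1)))⁻¹) ≤ η := by
      refine hadj (i, j + d) (i, j + (d + 1)) (by omega) hd (by omega) (by omega) (by omega) (by omega) ?_
      simp only [Nat.dist_self, zero_add]
      rw [Nat.dist_eq_sub_of_le (by omega)]; omega
    calc dist1 (φ (i, j) * (φ (i, j + (d + 1)))⁻¹)
        ≤ dist1 (φ (i, j) * (φ (i, j + d))⁻¹) + dist1 (φ (i, j + d) * (φ (i, j + (d + 1)))⁻¹) := dist1_mul_inv_le_via _ _ _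
      _ ≤ d * η + η := add_le_add (ih hd) hstep
      _ = ((d + 1 : ℕ) : ℝ) * η := by push_cast; ring

/-- Two-sided ROW form: `dist1 (φ (i₁,j)·(φ (i₂,j))⁻¹) ≤ (Nat.dist i₁ i₂)·η` on a boundary row. [folklore] -/
theorem dist1_row_le (n : ℕ) (φ : ℕ × ℕ → G) {η : ℝ}
    (hadj : ∀ P Q : ℕ × ℕ, P.1 ≤ n → P.2 ≤ n → (P.1 = 0 ∨ P.1 = n ∨ P.2 = 0 ∨ P.2 = n) → Q.1 ≤ n → Q.2 ≤ n → (Q.1 = 0 ∨ Q.1 = n ∨ Q.2 = 0 ∨ Q.2 = n) →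
      Nat.dist P.1 Q.1 + Nat.dist P.2 Q.2 = 1 → dist1 (φ P * (φ Q)⁻¹) ≤ η)
    (j : ℕ) (hj : j = 0 ∨ j = n) (i₁ i₂ : ℕ) (h₁ : i₁ ≤ n) (h₂ : i₂ ≤ n) :
    dist1 (φ (i₁, j) * (φ (i₂, j))⁻¹) ≤ (Nat.dist i₁ i₂ : ℕ) * η := by
  rcases le_total i₁ i₂ with h | h
  · have := dist1_row_segment_le n φ hadj j hj i₁ (i₂ - i₁) (by omega)
    rwa [show i₁ + (i₂ - i₁) = i₂ by omega, ← Nat.dist_eq_sub_of_le h] at this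
  · have := dist1_row_segment_le n φ hadj j hj i₂ (i₁ - i₂) (by omega)
    rw [show i₂ + (i₁ - i₂) = i₁ by omega, ← Nat.dist_eq_sub_of_le_right h] at this
    rwa [← GaugeGroup.dist1_inv, mul_inv_rev, inv_inv]

/-- Two-sided COLUMN form. [folklore] -/
theorem dist1_col_le (n : ℕ) (φ : ℕ × ℕ → G) {η : ℝ}
    (hadj : ∀ P Q : ℕ × ℕ, P.1 ≤ n → P.2 ≤ n → (P.1 = 0 ∨ P.1 = n ∨ P.2 = 0 ∨ P.2 = n) → Q.1 ≤ n → Q.2 ≤ n → (Q.1 = 0 ∨ Q.1 = n ∨ Q.2 = 0 ∨ Q.2 = n) →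
      Nat.dist P.1 Q.1 + Nat.dist P.2 Q.2 = 1 → dist1 (φ P * (φ Q)⁻¹) ≤ η)
    (i : ℕ) (hi : i = 0 ∨ i = n) (j₁ j₂ : ℕ) (h₁ : j₁ ≤ n) (h₂ : j₂ ≤ n) :
    dist1 (φ (i, j₁) * (φ (i, j₂))⁻¹) ≤ (Nat.dist j₁ j₂ : ℕ) * η := by
  rcases le_total j₁ j₂ with h | h
  · have := dist1_col_segment_le n φ hadj i hi j₁ (j₂ - j₁) (by omega)
    rwa [show j₁ + (j₂ - j₁) = j₂ by omega, ← Nat.dist_eq_sub_of_le h] at this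
  · have := dist1_col_segment_le n φ hadj i hi j₂ (j₁ - j₂) (by omega)
    rw [show j₂ + (j₁ - j₂) = j₁ by omega, ← Nat.dist_eq_sub_of_le_right h] at this
    rwa [← GaugeGroup.dist1_inv, mul_inv_rev, inv_inv]

/-! ## §2 The ring modulus -/

/-- From a path-length bound `ℓ ≤ 2·|Δ|₁` and `dist1 ≤ ℓ·η` to the modulus form. [folklore] -/
theorem le_two_mul_of_path {x η : ℝ} {ℓ D : ℕ} (hη : 0 ≤ η) (hx : x ≤ (ℓ : ℝ) * η) (hℓ : ℓ ≤ 2 * D) : x ≤ 2 * η * (D : ℝ) := by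
  have h : (ℓ : ℝ) ≤ 2 * (D : ℝ) := by exact_mod_cast hℓ
  calc x ≤ (ℓ : ℝ) * η := hx
    _ ≤ (2 * (D : ℝ)) * η := mul_le_mul_of_nonneg_right h hη
    _ = 2 * η * (D : ℝ) := by ring

/-- ★★★ **THE RING MODULUS OF THE SQUARE**: per-bond oscillation `η` along the boundary ring of `{0..n}²` gives `dist1 (φ P · (φ Q)⁻¹) ≤ 2η·(Nat.dist P.1 Q.1 + Nat.dist P.2 Q.2)`
for every pair of boundary sites (same∕adjacent sides: one corner turn, length `= |Δ|₁`; opposite sides: around the shorter way, length `≤ 2n ≤ 2|Δ|₁`). [folklore] -/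
theorem dist1_boundary_le_two_mul_l1 (n : ℕ) (φ : ℕ × ℕ → G) {η : ℝ} (hη : 0 ≤ η)
    (hadj : ∀ P Q : ℕ × ℕ, P.1 ≤ n → P.2 ≤ n → (P.1 = 0 ∨ P.1 = n ∨ P.2 = 0 ∨ P.2 = n) → Q.1 ≤ n → Q.2 ≤ n → (Q.1 = 0 ∨ Q.1 = n ∨ Q.2 = 0 ∨ Q.2 = n) →
      Nat.dist P.1 Q.1 + Nat.dist P.2 Q.2 = 1 → dist1 (φ P * (φ Q)⁻¹) ≤ η)
    (P Q : ℕ × ℕ) (hP1 : P.1 ≤ n) (hP2 : P.2 ≤ n) (hPb : P.1 = 0 ∨ P.1 = n ∨ P.2 = 0 ∨ P.2 = n)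
    (hQ1 : Q.1 ≤ n) (hQ2 : Q.2 ≤ n) (hQb : Q.1 = 0 ∨ Q.1 = n ∨ Q.2 = 0 ∨ Q.2 = n) :
    dist1 (φ P * (φ Q)⁻¹) ≤ 2 * η * ((Nat.dist P.1 Q.1 + Nat.dist P.2 Q.2 : ℕ) : ℝ) := by
  obtain ⟨p1, p2⟩ := P
  obtain ⟨q1, q2⟩ := Q
  simp only at hP1 hP2 hPb hQ1 hQ2 hQb ⊢
  by_cases hPv : p1 = 0 ∨ p1 = n
  · by_cases hQv : q1 = 0 ∨ q1 = n
    · by_cases heq : p1 = q1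
      · -- same column
        subst heq
        refine le_two_mul_of_path hη (dist1_col_le n φ hadj p1 hPv p2 q2 hP2 hQ2) ?_
        unfold Nat.dist; omega
      · -- opposite columns: around the shorter horizontal side `c ∈ {0, n}`
        have hc : ∃ c, (c = 0 ∨ c = n) ∧ Nat.dist p2 c + Nat.dist p1 q1 + Nat.dist c q2 ≤ 2 * (Nat.dist p1 q1 + Nat.dist p2 q2) := by
          by_cases hs : p2 + q2 ≤ n
          · exact ⟨0, Or.inl rfl, by unfold Nat.dist; omega⟩
          · exact ⟨n, Or.inr rfl, by unfold Nat.dist; omega⟩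
        obtain ⟨c, hcb, hlen⟩ := hc
        have hcn : c ≤ n := by omega
        have h1 := dist1_col_le n φ hadj p1 hPv p2 c hP2 hcn
        have h2 := dist1_row_le n φ hadj c hcb p1 q1 hP1 hQ1
        have h3 := dist1_col_le n φ hadj q1 hQv c q2 hcn hQ2
        refine le_two_mul_of_path hη ?_ hlen
        calc dist1 (φ (p1, p2) * (φ (q1, q2))⁻¹)
            ≤ dist1 (φ (p1, p2) * (φ (p1, c))⁻¹) + dist1 (φ (p1, c) * (φ (q1, q2))⁻¹) := dist1_mul_inv_le_via _ _ _
          _ ≤ dist1 (φ (p1, p2) * (φ (p1, c))⁻¹) + (dist1 (φ (p1, c) * (φ (q1, c))⁻¹) + dist1 (φ (q1, c) * (φ (q1, q2))⁻¹)) :=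
              add_le_add le_rfl (dist1_mul_inv_le_via _ _ _)
          _ ≤ (Nat.dist p2 c : ℕ) * η + ((Nat.dist p1 q1 : ℕ) * η + (Nat.dist c q2 : ℕ) * η) := add_le_add h1 (add_le_add h2 h3)
          _ = ((Nat.dist p2 c + Nat.dist p1 q1 + Nat.dist c q2 : ℕ) : ℝ) * η := by push_cast; ring
    · -- `P` on a column, `Q` on a row: turn at the corner `(p1, q2)`
      have hQh : q2 = 0 ∨ q2 = n := by omega
      have h1 := dist1_col_le n φ hadj p1 hPv p2 q2 hP2 hQ2
      have h2 := dist1_row_le n φ hadj q2 hQh p1 q1 hP1 hQ1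
      refine le_two_mul_of_path (ℓ := Nat.dist p2 q2 + Nat.dist p1 q1) hη ?_ (by omega)
      calc dist1 (φ (p1, p2) * (φ (q1, q2))⁻¹)
          ≤ dist1 (φ (p1, p2) * (φ (p1, q2))⁻¹) + dist1 (φ (p1, q2) * (φ (q1, q2))⁻¹) := dist1_mul_inv_le_via _ _ _
        _ ≤ (Nat.dist p2 q2 : ℕ) * η + (Nat.dist p1 q1 : ℕ) * η := add_le_add h1 h2
        _ = ((Nat.dist p2 q2 + Nat.dist p1 q1 : ℕ) : ℝ) * η := by push_cast; ring
  · have hPh : p2 = 0 ∨ p2 = n := by omega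
    by_cases hQh : q2 = 0 ∨ q2 = n
    · by_cases heq : p2 = q2
      · -- same row
        subst heq
        refine le_two_mul_of_path hη (dist1_row_le n φ hadj p2 hPh p1 q1 hP1 hQ1) ?_
        unfold Nat.dist; omega
      · -- opposite rows: around the shorter vertical side `c ∈ {0, n}`
        have hc : ∃ c, (c = 0 ∨ c = n) ∧ Nat.dist p1 c + Nat.dist p2 q2 + Nat.dist c q1 ≤ 2 * (Nat.dist p1 q1 + Nat.dist p2 q2) := by
          by_cases hs : p1 + q1 ≤ n
          · exact ⟨0, Or.inl rfl, by unfold Nat.dist; omega⟩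
          · exact ⟨n, Or.inr rfl, by unfold Nat.dist; omega⟩
        obtain ⟨c, hcb, hlen⟩ := hc
        have hcn : c ≤ n := by omega
        have h1 := dist1_row_le n φ hadj p2 hPh p1 c hP1 hcn
        have h2 := dist1_col_le n φ hadj c hcb p2 q2 hP2 hQ2
        have h3 := dist1_row_le n φ hadj q2 hQh c q1 hcn hQ1
        refine le_two_mul_of_path hη ?_ hlen
        calc dist1 (φ (p1, p2) * (φ (q1, q2))⁻¹)
            ≤ dist1 (φ (p1, p2) * (φ (c, p2))⁻¹) + dist1 (φ (c, p2) * (φ (q1, q2))⁻¹) := dist1_mul_inv_le_via _ _ _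
          _ ≤ dist1 (φ (p1, p2) * (φ (c, p2))⁻¹) + (dist1 (φ (c, p2) * (φ (c, q2))⁻¹) + dist1 (φ (c, q2) * (φ (q1, q2))⁻¹)) :=
              add_le_add le_rfl (dist1_mul_inv_le_via _ _ _)
          _ ≤ (Nat.dist p1 c : ℕ) * η + ((Nat.dist p2 q2 : ℕ) * η + (Nat.dist c q1 : ℕ) * η) := add_le_add h1 (add_le_add h2 h3)
          _ = ((Nat.dist p1 c + Nat.dist p2 q2 + Nat.dist c q1 : ℕ) : ℝ) * η := by push_cast; ring
    · -- `P` on a row, `Q` on a column: turn at the corner `(q1, p2)`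
      have hQv : q1 = 0 ∨ q1 = n := by omega
      have h1 := dist1_row_le n φ hadj p2 hPh p1 q1 hP1 hQ1
      have h2 := dist1_col_le n φ hadj q1 hQv p2 q2 hP2 hQ2
      refine le_two_mul_of_path (ℓ := Nat.dist p1 q1 + Nat.dist p2 q2) hη ?_ (by omega)
      calc dist1 (φ (p1, p2) * (φ (q1, q2))⁻¹)
          ≤ dist1 (φ (p1, p2) * (φ (q1, p2))⁻¹) + dist1 (φ (q1, p2) * (φ (q1, q2))⁻¹) := dist1_mul_inv_le_via _ _ _
        _ ≤ (Nat.dist p1 q1 : ℕ) * η + (Nat.dist p2 q2 : ℕ) * η := add_le_add h1 h2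
        _ = ((Nat.dist p1 q1 + Nat.dist p2 q2 : ℕ) : ℝ) * η := by push_cast; ring

end Summit.QuantumFields.YangMills.Theorems.FluctuationComparisonRegPrIntLS2BetaSquareRingModulus
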